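import Literature.AlgebraicGeometry.Frobenioids.ArchimedeanPointBaseProp35N
import Literature.AlgebraicGeometry.Frobenioids.ArchimedeanProp35ivSplitMono
import HarnessLib

/-!
# Frobenioids II, Proposition 3.5 (i)–(iv) AS TYPED: all ten instances hold over every FAITHFUL nonempty base
# functor `D → D₀` — and, hypothesis-free, at THE base of [IUTchI] Example 3.4 (i)

Mochizuki, *The geometry of Frobenioids II: poly-Frobenioids*, Kyushu J. Math. **62** (2008) 401–460, §3,
Proposition 3.5 (i)–(iv), kurims p. 34 (journal pp. 428–430) [cite: MochizukiFrdII2008, Prop 3.5 p.34]; the base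
category `D₀` and «`D` connected, totally epimorphic, with a functor `D → D₀`», Example 3.3 (i) p. 28, Definition
3.1 (i) p. 23 [cite: MochizukiFrdII2008, Def 3.1 (i) p.23]; base of *Inter-universal Teichmüller theory I*,
Example 3.4 (i), kurims text (May 2020) p. 80 [cite: Mochizuki2012, Ex 3.4 (i) p.80].

PROOF-ONLY consolidation (abc-iut cell, layer L1, chain LC-L1-2, DAG nodes `FrdII:Prop3.5(i)`–`(iv)`, FACT-LIST
rows F-0855…F-0866; seat abc-iut-w4-d027 gen 4, holder lineage of `FrdII:Prop3.5(iii)`). abc-iut-L1-t9's TEN typed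
instances of Prop. 3.5 over an ARBITRARY base functor `π : D → D₀` (`Prop35i_C/_A/_N/_R`, `Prop35ii_C/_A`,
`Prop35iii_N/_R`, `Prop35iv_C/_A`) have universal closures refuted in the tree: (i) [`C`, `A`, `N`] and (iii) [`N`]
at Galois-COLLAPSING base functors (`not_prop35i_C_collapse`, `not_prop35iii_N_collapse`, `P35iiiStd.not_prop35iii_N_std`);
(ii) at bases with a non-invertible retraction (`not_prop35ii_C_retract`); (iv) at the empty base and at a connected
base with a non-invertible split monomorphism (abc-iut-f-014). This file proves that ONE printed-style hypothesis
on the base functor rules out all of them at once — FAITHFULNESS of `π` (plus `D ≠ ∅` for (iv)):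

* **`isTotallyEpimorphic_of_faithful`** — a faithful `π : D → D₀` makes `D` totally epimorphic (`D₀` is, abc-iut-L1-t4's
  `D0.isTotallyEpimorphic`); **`isIso_of_isSplitMono_of_faithful`** — and makes every split monomorphism of `D`
  invertible (an idempotent endomorphism in `D₀` is an identity, `D0.eq_id_of_comp_self_eq`); so Ex. 3.3 (i)'s
  «totally epimorphic» is automatic over faithful bases, and NO base functor with a non-invertible split
  monomorphism is faithful (`not_faithful_of_isSplitMono_not_isIso`);
* **`galoisSaturated_of_injOn`** — a categorical-quotient datum `(B_D → A_D, G_D)` is Galois-saturated as soon as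
  `π` is injective ON `G_D` (sharpening abc-iut-w4-d100's `galoisSaturated_of_faithful`, whose module
  `ArchimedeanProp35iArithmeticBases` is ACCEPTED (p420323/p431522) but build-stranded at the time of filing — hence
  re-derived, not imported): were `π(G_D)` trivial over `Spec ℂ → Spec ℝ`, `G_D = 1` and `B_D → A_D` would split,
  giving an arrow `Spec ℝ → Spec ℂ`; so over a base functor REFLECTING TRIVIAL AUTOMORPHISMS (in particular a
  faithful one) every presentation supplied by «`D` of RC-iso-subanchor type» (Def. 3.1 (v)(d) as printed) is
  saturated — the REPAIRED hypothesis of this lineage's `ArchimedeanProp35iiiRepaired.lean` (p432131; the bridge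
  `IsOfSaturatedRCIsoSubanchorType` ← faithful is filed separately once that module's olean exists) — and (i) holds
  in all four instances (**`prop35i_all_of_reflects`**, via abc-iut-w4-d100's `prop35i_all_of_saturated`);
* hence AS TYPED over every FAITHFUL base functor: (i) all four instances (`prop35i_all_of_reflects`; = abc-iut-w4-d100's
  `prop35i_all_of_faithful` by name once its module builds),
  (ii) both (**`prop35ii_of_faithful`**, via abc-iut-f-007/L1-t9's `prop35ii_C/_A_of_splitMono`), (iii) both
  (**`prop35iii_of_faithful`**: `prop35iii_N_of_reflects` / `prop35iii_N_of_faithful` via gen 2's repaired form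
  `prop35iii_N_of_saturated`, and gen 2's unconditional `prop35iii_R_holds`; unfolded
  `N.isOfRCIsoSubanchorType_of_faithful`), (iv) both for `D`
  nonempty (**`prop35iv_of_faithful`**, via `prop35iv_C/_A_of_splitMono`) — packaged as
  **`prop35_all_of_faithful [π.Faithful] [Nonempty D]`**, with the contrapositive
  **`not_faithful_of_not_prop35_all`**: a nonempty base at which ANY typed instance fails is NOT faithful;
* **`prop35_all_of_forall_isComplex`** — all ten over a nonempty base functor with purely complex image whose
  split monomorphisms are invertible (faithfulness not needed for (i)/(iii) there: saturation is void);
* **`prop35_all_ptBase`** — ALL TEN at THE one-morphism base `Spec ℂ` of [IUTchI] Ex. 3.4 (i) (`ArchFrd.ptBase`),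
  no hypothesis: the form of Prop. 3.5 consumed at the archimedean places of IUT ((i) = abc-iut-w4-d100's
  `prop35i_all_ptBase` by name once its module builds; re-derived here from `prop35i_all_of_saturated`).

Nothing here bears on [IUTchIII] Cor. 3.12; no new definition, no new Prop fact; no side taken.
-/

namespace Literature.AlgebraicGeometry.Frobenioids

open CategoryTheory

noncomputable section

namespace ArchFrd

universe v u

/-- In `D₀` an idempotent endomorphism is the identity (`End(Spec ℝ) = {1}`; `End(Spec ℂ) = {1, conj}` with
`conj ∘ conj = 1 ≠ conj`). [cite: MochizukiFrdII2008, Def 3.1 (i) p.23] -/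
theorem D0.eq_id_of_comp_self_eq {K : D0} (e : K ⟶ K) (h : e ≫ e = e) : e = 𝟙 K := by
  rcases D0.isReal_or_isComplex K with hK | hK
  · exact D0.eq_id_of_isReal hK e
  · cases hK
    rcases D0.hom_complex_complex_eq e with he | he
    · exact he
    · subst he
      rw [D0.conj_comp_conj] at h
      exact h.symm

section General

variable {D : Type u} [Category.{v} D] (π : D ⥤ D0)

/-- **Over a FAITHFUL base functor `π : D → D₀`, every split monomorphism of `D` is invertible**: for a
retraction `r` of `s`, `r ≫ s` is idempotent, so `π (r ≫ s) = 1` in `D₀`, so `r ≫ s = 1` by faithfulness.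
[cite: MochizukiFrdII2008, Def 3.1 (i) p.23] -/
theorem isIso_of_isSplitMono_of_faithful [π.Faithful] ⦃a b : D⦄ (s : a ⟶ b) (hs : IsSplitMono s) : IsIso s := by
  obtain ⟨r⟩ := hs.exists_splitMono
  have hid : r.retraction ≫ s = 𝟙 b := by
    apply π.map_injective
    rw [π.map_id]
    refine D0.eq_id_of_comp_self_eq _ ?_
    rw [← π.map_comp, Category.assoc, reassoc_of% r.id]
  exact ⟨⟨r.retraction, r.id, hid⟩⟩

/-- **No base functor `D → D₀` with a non-invertible split monomorphism is faithful** (contrapositive of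
`isIso_of_isSplitMono_of_faithful`; applies to the «retract» bases refuting the typed Prop. 3.5 (ii) and to
abc-iut-f-014's connected base refuting the typed (iv)). [cite: MochizukiFrdII2008, Def 3.1 (i) p.23] -/
theorem not_faithful_of_isSplitMono_not_isIso {a b : D} (s : a ⟶ b) (hs : IsSplitMono s) (hns : ¬ IsIso s) :
    ¬ π.Faithful := fun _ =>
  hns (isIso_of_isSplitMono_of_faithful π s hs)

/-- **Over a FAITHFUL base functor `π : D → D₀`, `D` is totally epimorphic** ([FrdI] §0) — `D₀` is
(abc-iut-L1-t4's `D0.isTotallyEpimorphic`) and a faithful functor reflects the cancellation. So Ex. 3.3 (i)'s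
standing hypothesis «`D` totally epimorphic» is automatic over faithful bases. [cite: MochizukiFrdII2008, Ex 3.3 (i) p.28] -/
theorem isTotallyEpimorphic_of_faithful [π.Faithful] : IsTotallyEpimorphic D :=
  ⟨fun f => ⟨fun g h hgh => π.map_injective
    ((D0.isTotallyEpimorphic.epi (π.map f)).left_cancellation _ _
      (by simpa only [Functor.map_comp] using congrArg π.map hgh))⟩⟩

/-- **A categorical-quotient datum `(B_D → A_D, G_D)` over which `π` is injective ON `G_D` is Galois-saturated**
(sharpens abc-iut-w4-d100's `galoisSaturated_of_faithful`): otherwise `π B_D` is complex over a real `π A_D` and `π`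
kills `G_D` (`of_not_galoisSaturated`), so `G_D = 1`, the identity of `B_D` is `G_D`-invariant and factors through
the quotient `B_D → A_D`, and `π` of the factor would be an arrow `Spec ℝ → Spec ℂ` — there is none.
[cite: MochizukiFrdII2008, Prop 3.5 (i) p.34] -/
theorem galoisSaturated_of_injOn {BD AD : D} (fD : BD ⟶ AD) (GD : Subgroup (Aut BD))
    (hq : IsCategoricalQuotient GD fD) (hinj : ∀ g ∈ GD, π.map g.hom = 𝟙 (π.obj BD) → g = 1) :
    GaloisSaturated π fD GD := by
  by_contra hns
  obtain ⟨hBc, hAr, hkill⟩ := of_not_galoisSaturated π fD GD hns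
  obtain ⟨r, hr, -⟩ := hq.2 (𝟙 BD) (fun g hg => by
    have h1 : g = 1 := hinj g hg (hkill g hg)
    subst h1
    exact Category.id_comp _)
  have hreal : (π.obj BD).IsReal := UnitStab.D0.isReal_of_hom_real (π.map r) hAr
  unfold D0.IsReal at hreal
  unfold D0.IsComplex at hBc
  exact absurd (hreal.symm.trans hBc) (by decide)

/-- A FAITHFUL functor reflects trivial automorphisms: `π g = 1 ⇒ g = 1`. [cite: MochizukiFrdII2008, Def 3.1 (i) p.23] -/
theorem eq_one_of_map_hom_eq_id_of_faithful [π.Faithful] {BD : D} (g : Aut BD)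
    (h : π.map g.hom = 𝟙 (π.obj BD)) : g = 1 :=
  Iso.ext (π.map_injective (by rw [h, ← π.map_id]; rfl))

/-- **[FrdII] Prop. 3.5 (iii) for `N`, AS TYPED, over every base functor REFLECTING TRIVIAL AUTOMORPHISMS**: the
presentations supplied by «`D` of RC-iso-subanchor type» are Galois-saturated (`galoisSaturated_of_injOn`), so gen 2's
repaired form `prop35iii_N_of_saturated` applies. [cite: MochizukiFrdII2008, Prop 3.5 (iii) p.34] -/
theorem prop35iii_N_of_reflects (hπ : ∀ ⦃BD : D⦄ (g : Aut BD), π.map g.hom = 𝟙 (π.obj BD) → g = 1) :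
    Literature.AlgebraicGeometry.Frobenioids.ArchFrd.Prop35iii_N π := fun hRC =>
  prop35iii_N_of_saturated π fun AD => by
    obtain ⟨BD, GD, fD, hB, hq⟩ := hRC.isRCIsoSubanchor AD
    exact ⟨BD, GD, fD, hB, hq, galoisSaturated_of_injOn π fD GD hq.1 fun g _ hg => hπ g hg⟩

/-- **[FrdII] Prop. 3.5 (i) AS TYPED, all four instances (`C`, `A`, `N`, `R`), over every base functor REFLECTING
TRIVIAL AUTOMORPHISMS** — in particular every faithful one (abc-iut-w4-d100's `prop35i_all_of_faithful`) — via
abc-iut-w4-d100's `prop35i_all_of_saturated`. [cite: MochizukiFrdII2008, Prop 3.5 (i) p.34] -/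
theorem prop35i_all_of_reflects (hπ : ∀ ⦃BD : D⦄ (g : Aut BD), π.map g.hom = 𝟙 (π.obj BD) → g = 1) :
    Literature.AlgebraicGeometry.Frobenioids.ArchFrd.Prop35i_C π ∧
      Literature.AlgebraicGeometry.Frobenioids.ArchFrd.Prop35i_A π ∧
        Literature.AlgebraicGeometry.Frobenioids.ArchFrd.Prop35i_N π ∧
          Literature.AlgebraicGeometry.Frobenioids.ArchFrd.Prop35i_R π :=
  prop35i_all_of_saturated π fun _ _ fD GD hq => galoisSaturated_of_injOn π fD GD hq.1 fun g _ hg => hπ g hg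

/-- **[FrdII] Prop. 3.5 (iii) for `N`, AS TYPED, over every FAITHFUL base functor** `π : D → D₀`.
[cite: MochizukiFrdII2008, Prop 3.5 (iii) p.34] -/
theorem prop35iii_N_of_faithful [π.Faithful] :
    Literature.AlgebraicGeometry.Frobenioids.ArchFrd.Prop35iii_N π :=
  prop35iii_N_of_reflects π fun _ g hg => eq_one_of_map_hom_eq_id_of_faithful π g hg

/-- **`N` is of RC-iso-subanchor type** (w.r.t. `N → C → D → D₀`) over every FAITHFUL base functor `π : D → D₀` with
`D` of RC-iso-subanchor type — the printed conclusion of Prop. 3.5 (iii) for `G = N`, unfolded.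
[cite: MochizukiFrdII2008, Prop 3.5 (iii) p.34] -/
theorem N.isOfRCIsoSubanchorType_of_faithful [π.Faithful] (hRC : RC.IsOfRCIsoSubanchorType (baseRC π)) :
    RC.IsOfRCIsoSubanchorType (N.toC π ⋙ PreFrobenioid.baseFunctor (C.toElem π) ⋙ baseRC π) :=
  prop35iii_N_of_faithful π hRC

/-- **[FrdII] Prop. 3.5 (iii), both typed instances (`G = N` and `G = R`), over every FAITHFUL base functor**
(the `R`-instance is unconditional, gen 2's `prop35iii_R_holds`). [cite: MochizukiFrdII2008, Prop 3.5 (iii) p.34] -/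
theorem prop35iii_of_faithful [π.Faithful] :
    Literature.AlgebraicGeometry.Frobenioids.ArchFrd.Prop35iii_N π ∧
      Literature.AlgebraicGeometry.Frobenioids.ArchFrd.Prop35iii_R π :=
  ⟨prop35iii_N_of_faithful π, prop35iii_R_holds π⟩

/-- **[FrdII] Prop. 3.5 (ii), both typed instances (`F = C` and `F = A`), over every FAITHFUL base functor** — no
further hypothesis: split monomorphisms of `D` are invertible (`isIso_of_isSplitMono_of_faithful`), which is all
the «⇐» half needs (`prop35ii_C/_A_of_splitMono`). [cite: MochizukiFrdII2008, Prop 3.5 (ii) p.34] -/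
theorem prop35ii_of_faithful [π.Faithful] :
    Literature.AlgebraicGeometry.Frobenioids.ArchFrd.Prop35ii_C π ∧
      Literature.AlgebraicGeometry.Frobenioids.ArchFrd.Prop35ii_A π :=
  ⟨prop35ii_C_of_splitMono π (isIso_of_isSplitMono_of_faithful π),
    prop35ii_A_of_splitMono π (isIso_of_isSplitMono_of_faithful π)⟩

/-- **[FrdII] Prop. 3.5 (iv), both typed instances (`F = C` and `F = A`), over every FAITHFUL base functor on a
NONEMPTY `D`** (`prop35iv_C/_A_of_splitMono`; the empty base, where `C = A = ∅` is vacuously of RC-iso-subanchor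
type, is a genuine exception: `not_prop35iv_C_empty`). [cite: MochizukiFrdII2008, Prop 3.5 (iv) p.34] -/
theorem prop35iv_of_faithful [π.Faithful] [Nonempty D] :
    Literature.AlgebraicGeometry.Frobenioids.ArchFrd.Prop35iv_C π ∧
      Literature.AlgebraicGeometry.Frobenioids.ArchFrd.Prop35iv_A π :=
  ⟨prop35iv_C_of_splitMono π (isIso_of_isSplitMono_of_faithful π),
    prop35iv_A_of_splitMono π (isIso_of_isSplitMono_of_faithful π)⟩

/-- **[FrdII] Prop. 3.5 (i)–(iv) AS TYPED — ALL TEN instances — over every FAITHFUL base functor `π : D → D₀` on a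
nonempty `D`**: (i) for `C`, `A`, `N`, `R` (`prop35i_all_of_reflects`), (ii) for `C`, `A`
(`prop35ii_of_faithful`), (iii) for `N`, `R` (`prop35iii_of_faithful`), (iv) for `C`, `A` (`prop35iv_of_faithful`).
[cite: MochizukiFrdII2008, Prop 3.5 p.34] -/
theorem prop35_all_of_faithful [π.Faithful] [Nonempty D] :
    (Literature.AlgebraicGeometry.Frobenioids.ArchFrd.Prop35i_C π ∧
        Literature.AlgebraicGeometry.Frobenioids.ArchFrd.Prop35i_A π ∧
          Literature.AlgebraicGeometry.Frobenioids.ArchFrd.Prop35i_N π ∧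
            Literature.AlgebraicGeometry.Frobenioids.ArchFrd.Prop35i_R π) ∧
      (Literature.AlgebraicGeometry.Frobenioids.ArchFrd.Prop35ii_C π ∧
          Literature.AlgebraicGeometry.Frobenioids.ArchFrd.Prop35ii_A π) ∧
        (Literature.AlgebraicGeometry.Frobenioids.ArchFrd.Prop35iii_N π ∧
            Literature.AlgebraicGeometry.Frobenioids.ArchFrd.Prop35iii_R π) ∧
          (Literature.AlgebraicGeometry.Frobenioids.ArchFrd.Prop35iv_C π ∧
            Literature.AlgebraicGeometry.Frobenioids.ArchFrd.Prop35iv_A π) :=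
  ⟨prop35i_all_of_reflects π fun _ g hg => eq_one_of_map_hom_eq_id_of_faithful π g hg, prop35ii_of_faithful π,
    prop35iii_of_faithful π, prop35iv_of_faithful π⟩

/-- **Contrapositive: a NONEMPTY base functor at which any one of the ten typed instances of Prop. 3.5 fails is
NOT faithful** — the as-typed refutations in the tree all live over non-faithful (Galois-collapsing or
split-mono-non-inverting) base functors, or over the empty base. [cite: MochizukiFrdII2008, Prop 3.5 p.34] -/
theorem not_faithful_of_not_prop35_all [Nonempty D]
    (h : ¬ ((Literature.AlgebraicGeometry.Frobenioids.ArchFrd.Prop35i_C π ∧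
        Literature.AlgebraicGeometry.Frobenioids.ArchFrd.Prop35i_A π ∧
          Literature.AlgebraicGeometry.Frobenioids.ArchFrd.Prop35i_N π ∧
            Literature.AlgebraicGeometry.Frobenioids.ArchFrd.Prop35i_R π) ∧
      (Literature.AlgebraicGeometry.Frobenioids.ArchFrd.Prop35ii_C π ∧
          Literature.AlgebraicGeometry.Frobenioids.ArchFrd.Prop35ii_A π) ∧
        (Literature.AlgebraicGeometry.Frobenioids.ArchFrd.Prop35iii_N π ∧
            Literature.AlgebraicGeometry.Frobenioids.ArchFrd.Prop35iii_R π) ∧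
          (Literature.AlgebraicGeometry.Frobenioids.ArchFrd.Prop35iv_C π ∧
            Literature.AlgebraicGeometry.Frobenioids.ArchFrd.Prop35iv_A π))) :
    ¬ π.Faithful := fun _ =>
  h (prop35_all_of_faithful π)

/-- **[FrdII] Prop. 3.5 (i)–(iv) AS TYPED — ALL TEN instances — over every base functor with PURELY COMPLEX image
on a nonempty `D` whose split monomorphisms are invertible** (no faithfulness needed for (i)/(iii): Galois
saturation is void over complex objects, `galoisSaturated_of_isComplex` — cf. abc-iut-w4-d100's
`prop35i_all_of_forall_isComplex`; gen 3 `prop35iii_N_of_forall_isComplex`). [cite: MochizukiFrdII2008, Prop 3.5 p.34] -/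
theorem prop35_all_of_forall_isComplex [Nonempty D] (hc : ∀ d : D, (π.obj d).IsComplex)
    (hD : ∀ ⦃a b : D⦄ (s : a ⟶ b), IsSplitMono s → IsIso s) :
    (Literature.AlgebraicGeometry.Frobenioids.ArchFrd.Prop35i_C π ∧
        Literature.AlgebraicGeometry.Frobenioids.ArchFrd.Prop35i_A π ∧
          Literature.AlgebraicGeometry.Frobenioids.ArchFrd.Prop35i_N π ∧
            Literature.AlgebraicGeometry.Frobenioids.ArchFrd.Prop35i_R π) ∧
      (Literature.AlgebraicGeometry.Frobenioids.ArchFrd.Prop35ii_C π ∧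
          Literature.AlgebraicGeometry.Frobenioids.ArchFrd.Prop35ii_A π) ∧
        (Literature.AlgebraicGeometry.Frobenioids.ArchFrd.Prop35iii_N π ∧
            Literature.AlgebraicGeometry.Frobenioids.ArchFrd.Prop35iii_R π) ∧
          (Literature.AlgebraicGeometry.Frobenioids.ArchFrd.Prop35iv_C π ∧
            Literature.AlgebraicGeometry.Frobenioids.ArchFrd.Prop35iv_A π) :=
  ⟨prop35i_all_of_saturated π fun A _ fD GD _ => galoisSaturated_of_isComplex π fD GD (hc A.snd),
    ⟨prop35ii_C_of_splitMono π hD, prop35ii_A_of_splitMono π hD⟩,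
    ⟨prop35iii_N_of_forall_isComplex π hc, prop35iii_R_holds π⟩,
    ⟨prop35iv_C_of_splitMono π hD, prop35iv_A_of_splitMono π hD⟩⟩

end General

/-! ### At THE base of [IUTchI] Example 3.4 (i): the one-morphism category at `Spec ℂ` -/

/-- **[FrdII] Prop. 3.5 (i)–(iv) AS TYPED — ALL TEN instances — at the one-morphism base `Spec ℂ` of [IUTchI]
Ex. 3.4 (i) (`ArchFrd.ptBase`), NO hypothesis**: (i) via `prop35i_all_of_saturated` (= abc-iut-w4-d100's
`prop35i_all_ptBase`); (ii), (iv) gen 3's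
`prop35ii_C/_A_ptBase`, `prop35iv_C/_A_ptBase`; (iii) gen 3's `prop35iii_N_ptBase` and gen 2's `prop35iii_R_holds`.
This is the form of Prop. 3.5 consumed at the archimedean places `v ∈ 𝕍^arc` of IUT.
[cite: MochizukiFrdII2008, Prop 3.5 p.34] [cite: Mochizuki2012, Ex 3.4 (i) p.80] -/
theorem prop35_all_ptBase :
    (Literature.AlgebraicGeometry.Frobenioids.ArchFrd.Prop35i_C ptBase ∧
        Literature.AlgebraicGeometry.Frobenioids.ArchFrd.Prop35i_A ptBase ∧
          Literature.AlgebraicGeometry.Frobenioids.ArchFrd.Prop35i_N ptBase ∧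
            Literature.AlgebraicGeometry.Frobenioids.ArchFrd.Prop35i_R ptBase) ∧
      (Literature.AlgebraicGeometry.Frobenioids.ArchFrd.Prop35ii_C ptBase ∧
          Literature.AlgebraicGeometry.Frobenioids.ArchFrd.Prop35ii_A ptBase) ∧
        (Literature.AlgebraicGeometry.Frobenioids.ArchFrd.Prop35iii_N ptBase ∧
            Literature.AlgebraicGeometry.Frobenioids.ArchFrd.Prop35iii_R ptBase) ∧
          (Literature.AlgebraicGeometry.Frobenioids.ArchFrd.Prop35iv_C ptBase ∧
            Literature.AlgebraicGeometry.Frobenioids.ArchFrd.Prop35iv_A ptBase) :=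
  ⟨prop35i_all_of_saturated ptBase fun _ _ fD GD _ => galoisSaturated_of_isComplex ptBase fD GD rfl,
    ⟨prop35ii_C_ptBase, prop35ii_A_ptBase⟩, ⟨prop35iii_N_ptBase, prop35iii_R_holds ptBase⟩,
    ⟨prop35iv_C_ptBase, prop35iv_A_ptBase⟩⟩

/-- `ptBase` itself is faithful (the one-morphism category embeds into `D₀`), so `prop35_all_of_faithful` also
applies to it — recorded as an example of the faithful route. [cite: Mochizuki2012, Ex 3.4 (i) p.80] -/
theorem ptBase_faithful : ptBase.Faithful :=
  ⟨fun _ => Subsingleton.elim _ _⟩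

end ArchFrd

end

end Literature.AlgebraicGeometry.Frobenioids
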